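import Literature.Combinatorics.Designs.GoethalsSeidelArray

/-!
# T-sequences and the Cooper–Wallis construction of Hadamard matrices of order `4n`

[Cooper–J. Wallis, Bull. Austral. Math. Soc. 7 (1972) 269–277] (`CooperWallis1972`), Theorems 1–2: four `(0, ±1)`
circulant matrices `X₁, …, X₄` of order `n` with disjoint supports and `Σ Xᵢ Xᵢᵀ = n·I` ("T-matrices") give, through
`±1` combinations `Yᵢ = Σⱼ εᵢⱼ Xⱼ` with `Σ Yᵢ Yᵢᵀ = 4n·I` and the Goethals–Seidel array, a Hadamard (Baumert–Hall)
array and hence a Hadamard matrix of order `4n` — in the form of [Seberry–Yamada, *Hadamard Matrices* (Wiley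
2020)] (`SeberryYamada2020`) Theorem 3.11: `A = X₁+X₂+X₃+X₄, B = -X₁+X₂+X₃-X₄, C = -X₁-X₂+X₃+X₄, D = -X₁+X₂-X₃+X₄`
plugged into the Goethals–Seidel array.  The first rows of such T-matrices are *T-sequences*: four
`{0, ±1}`-sequences of length `n` with exactly one non-zero entry in each position and aperiodic autocorrelations
summing to `0` at every shift `s ≥ 1` [SY 2020 Definition 1.60; Best–Đoković–Kharaghani–Ramp, J. Combin. Des. 21
(2013) 24–35 = arXiv:1206.4107, §5] (`BestDjokovicKharaghaniRamp2013`).  This is the final step of the route Turyn-type sequences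
→ base sequences → T-sequences → Hadamard matrix by which the order `428` was settled (Kharaghani–Tayfeh-Rezaie
2005) and by which `TT(56)` would settle the order `668` (BDKR 2013, §1); the first two steps are formalised in
`Literature/Combinatorics/Designs/BaseSequences.lean`.

PROVED here, for general `n`:
* `paf_periodize` — reading a length-`n` sequence on `ZMod n`, the periodic autocorrelation is
  `PAF(s) = N(s) + N(n - s)` (`N` the aperiodic autocorrelation `NPAF`) [SY 2020 Lemma 1.21];
* `sum_cwRow_mul`, `sum_npaf_cwRow` — for the four sign combinations `a = t₀+t₁+t₂+t₃`, `b = -t₀+t₁+t₂-t₃`,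
  `c = -t₀-t₁+t₂+t₃`, `d = -t₀+t₁-t₂+t₃` (a `±1` matrix `M` with `Mᵀ M = 4 I`; Cooper–Wallis use the equivalent
  one-minus-sign pattern) one has `Σ_rows N_row(s) = 4 Σ_k N_{t_k}(s)`;
* `tseq_isHadamard` — **T-sequences of length `n` give a Hadamard matrix of order `4n`**: the four combinations are
  `±1` sequences (`isPM_cwSeq`) whose periodic autocorrelations sum to `0` off the origin (`sum_paf_cwSeq`), so the
  formalised Goethals–Seidel theorem `goethalsSeidel_isHadamard` applies [CooperWallis1972, Thms 1–2, with trivial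
  Williamson matrices of order 1].
  -- TODO(general form): Cooper–Wallis Theorem 3 plugs Williamson-type matrices of order `w` into the array and
  -- gives order `4nw`; only `w = 1` is formalised.

Formalisation choices.  Finite sequences are functions `ℕ → ℤ` together with an explicit length (values beyond the
length are never read): this makes concatenation, zero-padding and shifts (needed in `BaseSequences`) free of `Fin`
casts; `NPAF n x s = Σ_{i < n - s} x i · x (i + s)` is a `Finset.range` sum, so `NPAF n x s = 0` automatically for
`s ≥ n`, and the defining conditions are stated with bounded quantifiers (`∀ s < n, s ≠ 0 → …`) so that concrete
instances are `decide`-able.  T-sequences are `t : Fin 4 → ℕ → ℤ`.  The bridge to the `ZMod n`-indexed sequences of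
`LegendrePairs` / `GoethalsSeidelArray` is `periodize n x i = x i.val`.  Cell pub-namedobj (venture DiscreteObjects),
target H: the typed skeleton of the T-sequence family at `v = 167`.  No `sorry`, no new axioms.
-/

open Finset BigOperators Matrix

namespace Literature.Combinatorics.Designs.TSequences

open Literature.Combinatorics.Designs.LegendrePairs (PAF IsPM)
open Literature.Combinatorics.Designs.GoethalsSeidel (gsMatrix IsHadamardMatrix goethalsSeidel_isHadamard)

/-! ## §1 Aperiodic autocorrelation of a finite sequence -/

/-- aperiodic (non-periodic) autocorrelation `N_x(s) = Σ_{i + s < n} x_i x_{i+s}` of the length-`n` sequence `x`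
(the coefficient of `x^s` in the norm `N(A) = A(x)A(x⁻¹)` of BDKR 2013 §1).
[cite: SeberryYamada2020, Definition 1.40 (1.14)] -/
def NPAF (n : ℕ) (x : ℕ → ℤ) (s : ℕ) : ℤ := ∑ i ∈ range (n - s), x i * x (i + s)

/-- the sequence is `±1`-valued on its first `n` positions ("binary sequence of length `n`", BDKR 2013 §1;
"(1, -1) sequence", SY 2020 §1.10). [cite: SeberryYamada2020, Definition 1.45 ((1,-1) sequences of length n)] -/
def PMOn (n : ℕ) (x : ℕ → ℤ) : Prop := ∀ i < n, x i = 1 ∨ x i = -1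

/-- `N_x(s) = 0` for `s ≥ n`: the defining sum (1.14) is empty beyond `s = n - 1`.
[cite: SeberryYamada2020, Definition 1.40 (1.14)] -/
lemma npaf_of_le {n s : ℕ} (x : ℕ → ℤ) (h : n ≤ s) : NPAF n x s = 0 := by
  simp [NPAF, Nat.sub_eq_zero_of_le h]

/-! ## §2 T-sequences -/

/-- **T-sequences** of length `n`: four `{0, ±1}`-sequences `t 0, …, t 3` such that in each position `i < n` exactly
one of `t k i` is non-zero (and it is `±1`), and `Σ_k N_{t_k}(s) = 0` for every shift `1 ≤ s` (stated for `s < n`;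
for `s ≥ n` it is automatic, `IsTSeq.npaf`); BDKR 2013 §5. [cite: SeberryYamada2020, Definition 1.60] -/
def IsTSeq (n : ℕ) (t : Fin 4 → ℕ → ℤ) : Prop :=
  (∀ i < n, ∃ k, (t k i = 1 ∨ t k i = -1) ∧ ∀ k', k' ≠ k → t k' i = 0) ∧
    ∀ s < n, s ≠ 0 → ∑ k, NPAF n (t k) s = 0

/-- the autocorrelation condition of T-sequences at every shift `s ≠ 0`. [cite: SeberryYamada2020, Definition 1.60] -/
lemma IsTSeq.npaf {n : ℕ} {t : Fin 4 → ℕ → ℤ} (ht : IsTSeq n t) {s : ℕ} (hs : s ≠ 0) :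
    ∑ k, NPAF n (t k) s = 0 := by
  by_cases h : s < n
  · exact ht.2 s h hs
  · simp [npaf_of_le _ (not_lt.mp h)]

/-! ## §3 The Cooper–Wallis sign combinations -/

/-- the sign pattern of the four `±1` combinations (rows: `a, b, c, d`; columns: `t₀, …, t₃`): the Cooper–Wallis
matrices `A = aX₁+bX₂+cX₃+dX₄, B = -bX₁+aX₂+dX₃-cX₄, C = -cX₁-dX₂+aX₃+bX₄, D = -dX₁+cX₂-bX₃+aX₄` at `a = b = c = d = 1`;
a `±1` matrix `M` with `Mᵀ M = 4 I`. [cite: SeberryYamada2020, Theorem 3.11 (Cooper–J. Wallis)] -/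
def cwSign : Fin 4 → Fin 4 → ℤ :=
  ![![1, 1, 1, 1], ![-1, 1, 1, -1], ![-1, -1, 1, 1], ![-1, 1, -1, 1]]

/-- the entries of the sign pattern are `±1`. [cite: SeberryYamada2020, Theorem 3.11] -/
lemma cwSign_pm (p k : Fin 4) : cwSign p k = 1 ∨ cwSign p k = -1 := by
  fin_cases p <;> fin_cases k <;> simp [cwSign]

/-- the four Cooper–Wallis combinations `row_p = Σ_k ε_{pk} t_k`, i.e. `a = t₀+t₁+t₂+t₃`, `b = -t₀+t₁+t₂-t₃`,
`c = -t₀-t₁+t₂+t₃`, `d = -t₀+t₁-t₂+t₃` (first rows of `A, B, C, D` of Theorem 3.11 at `a = b = c = d = 1`).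
[cite: SeberryYamada2020, Theorem 3.11 (Cooper–J. Wallis)] -/
def cwRow (t : Fin 4 → ℕ → ℤ) (p : Fin 4) : ℕ → ℤ := fun i => ∑ k, cwSign p k * t k i

/-- pointwise orthogonality of the sign pattern: `Σ_p row_p(i) row_p(j) = 4 Σ_k t_k(i) t_k(j)` (the computation
`Σ Yᵢ Yᵢᵀ = 4 Σ Xᵢ Xᵢᵀ`). [cite: CooperWallis1972, Theorem 1 (b)] -/
lemma sum_cwRow_mul (t : Fin 4 → ℕ → ℤ) (i j : ℕ) :
    ∑ p, cwRow t p i * cwRow t p j = 4 * ∑ k, t k i * t k j := by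
  simp [cwRow, cwSign, Fin.sum_univ_four]
  ring

/-- hence `Σ_p N_{row_p}(s) = 4 Σ_k N_{t_k}(s)` for the aperiodic autocorrelations.
[cite: CooperWallis1972, Theorem 1 (b)] -/
lemma sum_npaf_cwRow (n : ℕ) (t : Fin 4 → ℕ → ℤ) (s : ℕ) :
    ∑ p, NPAF n (cwRow t p) s = 4 * ∑ k, NPAF n (t k) s := by
  simp only [NPAF]
  calc ∑ p, ∑ i ∈ range (n - s), cwRow t p i * cwRow t p (i + s)
      = ∑ i ∈ range (n - s), ∑ p, cwRow t p i * cwRow t p (i + s) := Finset.sum_comm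
    _ = ∑ i ∈ range (n - s), 4 * ∑ k, t k i * t k (i + s) := by simp_rw [sum_cwRow_mul]
    _ = 4 * ∑ i ∈ range (n - s), ∑ k, t k i * t k (i + s) := by rw [Finset.mul_sum]
    _ = 4 * ∑ k, ∑ i ∈ range (n - s), t k i * t k (i + s) := by rw [Finset.sum_comm]

/-- in each position the combination `row_p` takes the value `±(the unique non-zero t_k)`, so it is `±1`.
[cite: CooperWallis1972, Theorem 1 (proof: the Yᵢ are (1,-1) matrices)] -/
lemma cwRow_pm {n : ℕ} {t : Fin 4 → ℕ → ℤ} (ht : IsTSeq n t) (p : Fin 4) {i : ℕ} (hi : i < n) :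
    cwRow t p i = 1 ∨ cwRow t p i = -1 := by
  obtain ⟨k, hk, h0⟩ := ht.1 i hi
  have hrow : cwRow t p i = cwSign p k * t k i := by
    unfold cwRow
    rw [Finset.sum_eq_single k]
    · intro k' _ hk'
      rw [h0 k' hk', mul_zero]
    · intro h
      exact absurd (mem_univ k) h
  rw [hrow]
  rcases cwSign_pm p k with h1 | h1 <;> rcases hk with h2 | h2 <;> simp [h1, h2]

/-! ## §4 Periodisation: from aperiodic to periodic autocorrelation -/

section Periodic

variable {L : ℕ} [NeZero L]

/-- read a length-`L` sequence as a function on `ZMod L`, i.e. as the first row of a circulant matrix of order `L`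
("reducing `i + s` modulo `n`", SY 2020 (1.15)). [cite: SeberryYamada2020, Definition 1.42] -/
def periodize (L : ℕ) (x : ℕ → ℤ) : ZMod L → ℤ := fun i => x i.val

omit [NeZero L] in
/-- entries of the periodised sequence. [folklore] -/
@[simp] private lemma periodize_apply (x : ℕ → ℤ) (i : ZMod L) : periodize L x i = x i.val := rfl

/-- a sum over `ZMod L` of a function of `i.val` is the sum over `range L`. [folklore] -/
private lemma sum_zmod_val (g : ZMod L → ℤ) (f : ℕ → ℤ) (h : ∀ i, g i = f i.val) :
    ∑ i, g i = ∑ j ∈ range L, f j := by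
  refine Finset.sum_nbij' (fun i : ZMod L => i.val) (fun j : ℕ => (j : ZMod L)) ?_ ?_ ?_ ?_ ?_
  · intro a _
    exact mem_range.mpr (ZMod.val_lt a)
  · intro j _
    exact mem_univ _
  · intro a _
    exact ZMod.natCast_zmod_val a
  · intro j hj
    exact ZMod.val_cast_of_lt (mem_range.mp hj)
  · intro a _
    exact h a

/-- **periodic = aperiodic + wrapped aperiodic**: `P_x(s) = N_x(s) + N_x(L - s)` for a sequence of length `L`
read on `ZMod L` (at `s = 0` the second term is the empty sum). [cite: SeberryYamada2020, Lemma 1.21] -/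
theorem paf_periodize (x : ℕ → ℤ) (s : ZMod L) :
    PAF (periodize L x) s = NPAF L x s.val + NPAF L x (L - s.val) := by
  have hs : s.val < L := ZMod.val_lt s
  unfold PAF
  simp only [periodize_apply, ZMod.val_add]
  rw [sum_zmod_val _ (fun j => x j * x ((j + s.val) % L)) (fun i => rfl),
    ← Finset.sum_range_add_sum_Ico _ (Nat.sub_le L s.val)]
  congr 1
  · unfold NPAF
    refine sum_congr rfl fun j hj => ?_
    rw [mem_range] at hj
    rw [Nat.mod_eq_of_lt (by omega)]
  · rw [Finset.sum_Ico_eq_sum_range]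
    unfold NPAF
    refine sum_congr rfl fun k hk => ?_
    rw [mem_range] at hk
    have h1 : (L - s.val + k + s.val) % L = k := by
      rw [show L - s.val + k + s.val = k + L by omega, Nat.add_mod_right, Nat.mod_eq_of_lt (by omega)]
    rw [h1, mul_comm, Nat.add_comm (L - s.val) k]

end Periodic

/-! ## §5 T-sequences give Hadamard matrices of order `4n` -/

section Hadamard

variable {n : ℕ} [NeZero n] {t : Fin 4 → ℕ → ℤ}

/-- the four Goethals–Seidel first rows attached to T-sequences: the Cooper–Wallis combinations read on `ZMod n`
(T-sequences as first rows of circulant T-matrices, SY 2020 Theorem 3.10 (i), combined as in Theorem 3.11).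
[cite: SeberryYamada2020, Theorem 3.11 (Cooper–J. Wallis)] -/
def cwSeq (n : ℕ) (t : Fin 4 → ℕ → ℤ) (p : Fin 4) : ZMod n → ℤ := periodize n (cwRow t p)

/-- the four rows are `±1` sequences (`Σ Tᵢ` is a `(1,-1)` matrix). [cite: SeberryYamada2020, Theorem 3.11] -/
lemma isPM_cwSeq (ht : IsTSeq n t) (p : Fin 4) : IsPM (cwSeq n t p) :=
  fun i => cwRow_pm ht p (ZMod.val_lt i)

/-- the four rows have periodic autocorrelations summing to `0` at every non-zero shift (`Σ Yᵢ Yᵢᵀ = 4n I`;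
NPAF `= 0` ⇒ PAF `= 0`, SY 2020 Corollary 1.4). [cite: CooperWallis1972, Theorem 1 (b)] -/
theorem sum_paf_cwSeq (ht : IsTSeq n t) (s : ZMod n) (hs : s ≠ 0) : ∑ p, PAF (cwSeq n t p) s = 0 := by
  have hv : s.val ≠ 0 := fun h => hs ((ZMod.val_eq_zero s).mp h)
  have hv' : n - s.val ≠ 0 := by
    have := ZMod.val_lt s
    omega
  simp only [cwSeq, paf_periodize, Finset.sum_add_distrib, sum_npaf_cwRow, ht.npaf hv, ht.npaf hv', mul_zero,
    add_zero]

/-- **Cooper–Wallis.** T-sequences of length `n` give, through the four sign combinations and the Goethals–Seidel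
array, a Hadamard matrix of order `4n` (indexed by `Fin 4 × ZMod n`); Cooper–Wallis 1972 Theorems 1–2.
[cite: SeberryYamada2020, Theorem 3.11 (Cooper–J. Wallis)] -/
theorem tseq_isHadamard (ht : IsTSeq n t) :
    IsHadamardMatrix (gsMatrix (cwSeq n t 0) (cwSeq n t 1) (cwSeq n t 2) (cwSeq n t 3)) := by
  refine goethalsSeidel_isHadamard _ _ _ _ (isPM_cwSeq ht 0) (isPM_cwSeq ht 1) (isPM_cwSeq ht 2)
    (isPM_cwSeq ht 3) fun s hs => ?_
  have h := sum_paf_cwSeq ht s hs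
  simpa [Fin.sum_univ_four, add_assoc] using h

/-- existence form: T-sequences of length `n` ⇒ a Hadamard matrix of order `4n` ("T-matrices of order t give
Hadamard matrices of order 4t", SY 2020 §1.16). [cite: SeberryYamada2020, Theorem 3.11 (Cooper–J. Wallis)] -/
theorem exists_hadamard_of_tseq (ht : IsTSeq n t) :
    ∃ H : Matrix (Fin 4 × ZMod n) (Fin 4 × ZMod n) ℤ, IsHadamardMatrix H :=
  ⟨_, tseq_isHadamard ht⟩

end Hadamard

end Literature.Combinatorics.Designs.TSequences
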